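import Mathlib
import Literature.NumberTheory.Transcendental.RoyCriterion
import Literature.NumberTheory.Transcendental.RoyCriterionProofs
import Summits.Schanuel.Schanuel.Theorems.SoloBlindPadeContent
import HarnessLib

/-!
# The box-restricted content of the Hermite–Padé jet lattice of `exp` (Theorem V(i))

Notation as in `SoloBlindPadeContent` (Theorem U): for `P ∈ ℤ[X₀,X₁]`,
`c_n(P) = taylorInt n P = (d/dw)ⁿ P(w, e^w)|_{w=0}`.

**Theorem V(i) (degree-aware divisibility).** If `deg_{X₀} P ≤ T` and `c_n(P) = 0` for all
`n < m`, then for every prime `p`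
  `|c_m(P)|_p ≤ p^{−v_p(m!) + T·⌊log_p m⌋}`,  i.e.  `p^{v_p(m!) − T⌊log_p m⌋} ∣ c_m(P)`,
and together with Theorem U, `p^{v_p(m!) − min(⌊m/p⌋, T⌊log_p m⌋)} ∣ c_m(P)`.

*Proof (algebraic).* With `z = e^w − 1`, `Φ(P) = P(log(1+z), 1+z)` and
`c_m(P) = m!·[zᵐ]Φ(P)` (order transfer, Theorem U file). The coefficient `[zʲ](log(1+z))^a` is a
sum of `±1/(j₁⋯j_a)` with `j₁+…+j_a = j`, so `|[zʲ]L^a|_p ≤ p^{a⌊log_p j⌋}`; the profile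
`|f_j|_p ≤ p^{a⌊log_p j⌋}` is additive in `a` under products (monotonicity of `⌊log_p ·⌋`) and
`ℤ[1+z]` has profile `0`, so `Φ(P)` has profile `T` when `deg_{X₀} P ≤ T`.

This is the `T₀`-dependent half of the lower bound `v_p(g_m(T₀,T₁)) ≥ v_p(m!) − min(⌊m/p⌋,
T₀⌊log_p m⌋)` for the content of the jet functional `c_m` on the box module of order `≥ m`
(solo paper §3d, Theorem V(i)); it enters the Bombieri–Vaaler covolume of the Padé lattices in
Roy's programme and changes constants, not exponents (wall R-A9). Def-free: the profile is the
hypothesis `∀ j, padicNorm p (coeff j f) ≤ p ^ (a * Nat.log p j)`. [this work] -/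

noncomputable section

open Finset PowerSeries

namespace Summit.Schanuel.Schanuel.Theorems

open Literature.NumberTheory.Transcendental

/-! ### The logarithmic profile `S_p^{(a)} = {f : |f_j|_p ≤ p^{a·⌊log_p j⌋} ∀ j}` -/

/-- A series with integer coefficients has logarithmic profile `a` for every `a`. [this work] -/
theorem mem_jetLogSp_of_int {p : ℕ} [Fact p.Prime] (a : ℕ) {f : ℚ⟦X⟧}
    (h : ∀ j, ∃ z : ℤ, coeff j f = z) :
    ∀ j, padicNorm p (coeff j f) ≤ (p : ℚ) ^ (a * Nat.log p j) := by
  intro j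
  obtain ⟨z, hz⟩ := h j
  rw [hz]
  exact (padicNorm.of_int z).trans
    (one_le_pow₀ (by exact_mod_cast (Fact.out : p.Prime).one_lt.le))

/-- The logarithmic profiles increase with `a`. [this work] -/
theorem jetLogSp_mono {p : ℕ} [Fact p.Prime] {a b : ℕ} (hab : a ≤ b) {f : ℚ⟦X⟧}
    (hf : ∀ j, padicNorm p (coeff j f) ≤ (p : ℚ) ^ (a * Nat.log p j)) :
    ∀ j, padicNorm p (coeff j f) ≤ (p : ℚ) ^ (b * Nat.log p j) := by
  intro j
  have hp1 : (1 : ℚ) ≤ p := by exact_mod_cast (Fact.out : p.Prime).one_lt.le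
  exact (hf j).trans (pow_le_pow_right₀ hp1 (Nat.mul_le_mul_right _ hab))

/-- Logarithmic profile `a` is closed under addition. [this work] -/
theorem jetLogSp_add_mem {p : ℕ} [Fact p.Prime] {a : ℕ} {f g : ℚ⟦X⟧}
    (hf : ∀ j, padicNorm p (coeff j f) ≤ (p : ℚ) ^ (a * Nat.log p j))
    (hg : ∀ j, padicNorm p (coeff j g) ≤ (p : ℚ) ^ (a * Nat.log p j)) :
    ∀ j, padicNorm p (coeff j (f + g)) ≤ (p : ℚ) ^ (a * Nat.log p j) := by
  intro j
  rw [map_add]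
  exact padicNorm.nonarchimedean.trans (max_le (hf j) (hg j))

/-- Logarithmic profile `a` is closed under finite sums. [this work] -/
theorem jetLogSp_sum_mem {p : ℕ} [Fact p.Prime] {a : ℕ} {ι : Type*} (s : Finset ι)
    {f : ι → ℚ⟦X⟧} (hf : ∀ i ∈ s, ∀ j, padicNorm p (coeff j (f i)) ≤ (p : ℚ) ^ (a * Nat.log p j)) :
    ∀ j, padicNorm p (coeff j (∑ i ∈ s, f i)) ≤ (p : ℚ) ^ (a * Nat.log p j) := by
  intro j
  rw [map_sum]
  exact padicNorm.sum_le' (fun i hi => hf i hi j) (by positivity)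

/-- Profiles add under multiplication: `a⌊log_p i⌋ + b⌊log_p (j−i)⌋ ≤ (a+b)⌊log_p j⌋`.
[this work] -/
theorem jetLogSp_mul_mem {p : ℕ} [Fact p.Prime] {a b : ℕ} {f g : ℚ⟦X⟧}
    (hf : ∀ j, padicNorm p (coeff j f) ≤ (p : ℚ) ^ (a * Nat.log p j))
    (hg : ∀ j, padicNorm p (coeff j g) ≤ (p : ℚ) ^ (b * Nat.log p j)) :
    ∀ j, padicNorm p (coeff j (f * g)) ≤ (p : ℚ) ^ ((a + b) * Nat.log p j) := by
  intro j
  have hp1 : (1 : ℚ) ≤ p := by exact_mod_cast (Fact.out : p.Prime).one_lt.le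
  rw [coeff_mul]
  refine padicNorm.sum_le' (fun x hx => ?_) (by positivity)
  rw [padicNorm.mul]
  have hsum : x.1 + x.2 = j := Finset.HasAntidiagonal.mem_antidiagonal.mp hx
  have h1 : Nat.log p x.1 ≤ Nat.log p j := Nat.log_mono_right (by omega)
  have h2 : Nat.log p x.2 ≤ Nat.log p j := Nat.log_mono_right (by omega)
  calc padicNorm p (coeff x.1 f) * padicNorm p (coeff x.2 g)
      ≤ (p : ℚ) ^ (a * Nat.log p x.1) * (p : ℚ) ^ (b * Nat.log p x.2) :=
        mul_le_mul (hf x.1) (hg x.2) (padicNorm.nonneg _) (by positivity)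
    _ = (p : ℚ) ^ (a * Nat.log p x.1 + b * Nat.log p x.2) := by rw [pow_add]
    _ ≤ (p : ℚ) ^ ((a + b) * Nat.log p j) := pow_le_pow_right₀ hp1 (by
        calc a * Nat.log p x.1 + b * Nat.log p x.2 ≤ a * Nat.log p j + b * Nat.log p j :=
              Nat.add_le_add (Nat.mul_le_mul_left _ h1) (Nat.mul_le_mul_left _ h2)
          _ = (a + b) * Nat.log p j := by ring)

/-- Powers: profile `a` to the `n` gives profile `n·a`. [this work] -/
theorem jetLogSp_pow_mem {p : ℕ} [Fact p.Prime] {a : ℕ} {f : ℚ⟦X⟧}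
    (hf : ∀ j, padicNorm p (coeff j f) ≤ (p : ℚ) ^ (a * Nat.log p j)) (n : ℕ) :
    ∀ j, padicNorm p (coeff j (f ^ n)) ≤ (p : ℚ) ^ (n * a * Nat.log p j) := by
  induction n with
  | zero =>
    intro j
    rw [pow_zero, zero_mul, zero_mul, pow_zero, coeff_one]
    split_ifs
    · rw [padicNorm.one]
    · rw [padicNorm.zero]; exact zero_le_one
  | succ n ih =>
    intro j
    rw [pow_succ]
    have := jetLogSp_mul_mem ih hf j
    calc padicNorm p (coeff j (f ^ n * f)) ≤ (p : ℚ) ^ ((n * a + a) * Nat.log p j) := this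
      _ = (p : ℚ) ^ ((n + 1) * a * Nat.log p j) := by ring_nf

/-- `1 + z` has logarithmic profile `0`. [this work] -/
theorem one_add_X_mem_jetLogSp {p : ℕ} [Fact p.Prime] :
    ∀ j, padicNorm p (coeff j (1 + X : ℚ⟦X⟧)) ≤ (p : ℚ) ^ (0 * Nat.log p j) := by
  refine mem_jetLogSp_of_int 0 fun j => ?_
  rcases j with _ | _ | j
  · exact ⟨1, by simp⟩
  · exact ⟨1, by simp⟩
  · exact ⟨0, by simp [coeff_X]⟩

/-- `ℤ[L, 1+z] ∋ Φ(P)` has logarithmic profile `T` when `L` has profile `1` and `deg_{X₀} P ≤ T`.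
[this work] -/
theorem aeval_logPair_mem_jetLogSp {p : ℕ} [Fact p.Prime] {L : ℚ⟦X⟧}
    (hL : ∀ j, padicNorm p (coeff j L) ≤ (p : ℚ) ^ (1 * Nat.log p j))
    (P : MvPolynomial (Fin 2) ℤ) {T : ℕ} (hP : P.degreeOf 0 ≤ T) :
    ∀ j, padicNorm p (coeff j (MvPolynomial.aeval ![L, 1 + X] P)) ≤
      (p : ℚ) ^ (T * Nat.log p j) := by
  rw [P.as_sum, map_sum]
  refine jetLogSp_sum_mem P.support fun s hs => ?_
  have hs0 : s 0 ≤ T := (MvPolynomial.monomial_le_degreeOf 0 hs).trans hP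
  rw [MvPolynomial.monomial_eq, Finsupp.prod_fintype _ _ (fun i => pow_zero _),
    Fin.prod_univ_two, map_mul, map_mul, map_pow, map_pow, aeval_logPair_C,
    aeval_logPair_X_zero, aeval_logPair_X_one]
  -- the three factors: the integer constant (profile 0), `L^{s 0}` (profile `s 0`),
  -- `(1+z)^{s 1}` (profile 0)
  have hC : ∀ j, padicNorm p (coeff j (C ((MvPolynomial.coeff s P : ℤ) : ℚ) : ℚ⟦X⟧)) ≤
      (p : ℚ) ^ (0 * Nat.log p j) := by
    refine mem_jetLogSp_of_int 0 fun j => ?_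
    rcases j with _ | j
    · exact ⟨MvPolynomial.coeff s P, by rw [coeff_zero_C]⟩
    · exact ⟨0, by rw [coeff_C, if_neg (Nat.add_one_ne_zero j), Int.cast_zero]⟩
  have hLpow := jetLogSp_pow_mem hL (s 0)
  have hXpow := jetLogSp_pow_mem (one_add_X_mem_jetLogSp (p := p)) (s 1)
  exact jetLogSp_mono (by simpa using hs0) (jetLogSp_mul_mem hC (jetLogSp_mul_mem hLpow hXpow))

/-- `log(1+z)` has logarithmic profile `1`: `|1/j|_p = p^{v_p(j)} ≤ p^{⌊log_p j⌋}`. [this work] -/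
theorem logSeries_mem_jetLogSp {p : ℕ} [hp : Fact p.Prime] : ∀ j, padicNorm p (coeff j
    (PowerSeries.mk fun j : ℕ => ite (j = 0) (0 : ℚ) ((-1) ^ (j + 1) / (j : ℚ)))) ≤
      (p : ℚ) ^ (1 * Nat.log p j) := by
  intro j
  rw [coeff_mk, one_mul]
  have hp1 : (1 : ℚ) ≤ p := by exact_mod_cast hp.out.one_lt.le
  split_ifs with hj
  · rw [padicNorm.zero]; positivity
  · rw [padicNorm.div, padicNorm.eq_zpow_of_nonzero (by positivity),
      show ((-1 : ℚ) ^ (j + 1)) = (((-1) ^ (j + 1) : ℤ) : ℚ) by push_cast; ring,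
      padicValRat.of_int, padicValInt, Int.natAbs_pow, Int.natAbs_neg, Int.natAbs_one, one_pow,
      padicValNat_one_right, padicNorm.eq_zpow_of_nonzero (by exact_mod_cast hj),
      padicValRat.of_nat]
    simp only [CharP.cast_eq_zero, neg_zero, zpow_zero, zpow_neg, zpow_natCast, one_div, inv_inv]
    exact pow_le_pow_right₀ hp1 (padicValNat_le_nat_log j)

/-! ### Theorem V(i) -/

/-- **Theorem V(i), `p`-adic form.** If `deg_{X₀} P ≤ T` and `c_n(P) = 0` for all `n < m`, then
`|c_m(P)|_p ≤ p^{−v_p(m!) + T⌊log_p m⌋}`. [this work] -/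
theorem padicNorm_taylorInt_le_of_degreeOf {p : ℕ} [hp : Fact p.Prime]
    (P : MvPolynomial (Fin 2) ℤ) {T : ℕ} (hP : P.degreeOf 0 ≤ T)
    {m : ℕ} (h : ∀ n < m, taylorInt n P = 0) :
    padicNorm p (taylorInt m P : ℚ) ≤
      (p : ℚ) ^ (-(padicValNat p m.factorial : ℤ) + (T * Nat.log p m : ℕ)) := by
  have hp0 : (p : ℚ) ≠ 0 := by exact_mod_cast hp.out.ne_zero
  have hL0 : constantCoeff
      (PowerSeries.mk fun j : ℕ => ite (j = 0) (0 : ℚ) ((-1) ^ (j + 1) / (j : ℚ))) = 0 := by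
    rw [← coeff_zero_eq_constantCoeff_apply, coeff_mk, if_pos rfl]
  rw [taylorInt_eq_factorial_mul_coeff (θ := fun f => (1 + X : ℚ⟦X⟧) * d⁄dX ℚ f) (fun f => rfl)
    one_add_X_mul_derivative_logSeries hL0 P h, padicNorm.mul,
    padicNorm.eq_zpow_of_nonzero (by positivity), ← padicValRat_of_nat, zpow_add₀ hp0,
    zpow_natCast]
  exact mul_le_mul_of_nonneg_left (aeval_logPair_mem_jetLogSp logSeries_mem_jetLogSp P hP m)
    (by positivity)

/-- **Theorem V(i) (divisibility, prime by prime).** If `deg_{X₀} P ≤ T` and `taylorInt n P = 0`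
for all `n < m`, then `p^{v_p(m!) − T⌊log_p m⌋} ∣ taylorInt m P` (truncated subtraction).
[this work] -/
theorem pow_sub_log_dvd_taylorInt {p : ℕ} [hp : Fact p.Prime] (P : MvPolynomial (Fin 2) ℤ)
    {T : ℕ} (hP : P.degreeOf 0 ≤ T) {m : ℕ} (h : ∀ n < m, taylorInt n P = 0) :
    ((p ^ (padicValNat p m.factorial - T * Nat.log p m) : ℕ) : ℤ) ∣ taylorInt m P := by
  have hp1 : (1 : ℚ) ≤ p := by exact_mod_cast hp.out.one_lt.le
  rcases le_or_gt (T * Nat.log p m) (padicValNat p m.factorial) with hle | hlt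
  · refine padicNorm.dvd_iff_norm_le.mpr ((padicNorm_taylorInt_le_of_degreeOf P hP h).trans ?_)
    refine zpow_le_zpow_right₀ hp1 ?_
    generalize T * Nat.log p m = N at hle ⊢
    omega
  · -- trivial range: the exponent is `0`
    rw [Nat.sub_eq_zero_of_le hlt.le, pow_zero, Nat.cast_one]
    exact one_dvd _

/-- **Theorem V(i) with Theorem U.** Under the same hypotheses,
`p^{max(v_p(⌊m/p⌋!), v_p(m!) − T⌊log_p m⌋)} ∣ taylorInt m P`, i.e.
`v_p(c_m(P)) ≥ v_p(m!) − min(⌊m/p⌋, T⌊log_p m⌋)` (Legendre: `v_p(m!) − ⌊m/p⌋ = v_p(⌊m/p⌋!)`).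
[this work] -/
theorem pow_max_dvd_taylorInt {p : ℕ} [hp : Fact p.Prime] (P : MvPolynomial (Fin 2) ℤ)
    {T : ℕ} (hP : P.degreeOf 0 ≤ T) {m : ℕ} (h : ∀ n < m, taylorInt n P = 0) :
    ((p ^ max (padicValNat p (m / p).factorial)
        (padicValNat p m.factorial - T * Nat.log p m) : ℕ) : ℤ) ∣ taylorInt m P := by
  rcases le_total (padicValNat p (m / p).factorial)
      (padicValNat p m.factorial - T * Nat.log p m) with hle | hle
  · rw [max_eq_right hle]; exact pow_sub_log_dvd_taylorInt P hP h
  · rw [max_eq_left hle]; exact pow_padicValNat_dvd_taylorInt P h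

/-- The exponent in `pow_max_dvd_taylorInt` is `v_p(m!) − min(⌊m/p⌋, T⌊log_p m⌋)`. [this work] -/
theorem max_padicValNat_eq_sub_min {p : ℕ} [hp : Fact p.Prime] (m T : ℕ) :
    max (padicValNat p (m / p).factorial) (padicValNat p m.factorial - T * Nat.log p m) =
      padicValNat p m.factorial - min (m / p) (T * Nat.log p m) := by
  have h := padicValNat_factorial_eq_div (p := p) m
  generalize T * Nat.log p m = N at *
  generalize m / p = q at *
  omega

end Summit.Schanuel.Schanuel.Theorems

end
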